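import Mathlib
import HarnessLib
import Summits.HubbardSuperconductivity.HubbardSuperconductivity.Theorems.KLProgrammeKLRegimeSplitEdgeFactsDeepCondition

/-!
# Route `KLProgramme` — edge facts for the pair masses ACROSS TRANSFERS, XX′: the DEEP CONDITION in the pair-class vocabulary for an ABSTRACT jet constant `v` —
# `IsPairClassAt L Q (j + m₀)` and `512·v ≤ 4^{m₀}` ⟹ `v·|p_Q|_𝕋 ≤ Λ_j/16`; `v ≤ 32 ⇒ m₀ = 7`

Cell gate-hubbard-kl, seat hubbard-kl-k3c1-p1 (g22; child-1 lineage); cure of the located «(s2)-JETS-COEFFNORM-KEYING».  Row 34 (`…DeepCondition`) states the bridge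
for `v = 4 + coeffNorm 1 K` and the numeral for `coeffNorm 1 K ≤ 16`; the abstract twins of rows 21–32 (`…RungJetsV`, …, `…PinnedFloorWindowV`) carry an ABSTRACT
first-jet constant `v` (regime-native choice `v = 4 + 2A_K` with `‖Dʲ(frameShift K)‖ ≤ A_K`, `…BandJetsSup`).  THIS FILE is the same one-line bridge for any
`0 ≤ v`: **`kldcv_deep_of_isPairClassAt`** (`|p_Q|_𝕋 ≤ 4^{−(j+m₀)}` and `512·v ≤ 4^{m₀}` ⟹ `v·|p_Q|_𝕋 ≤ Λ_j/16`, `Λ_j = 4^{−j}/32`) and the numeral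
**`kldcv_numeral_m₀`** (`v ≤ 32 ⟹ 512·v ≤ 4⁷`: seven edge scales suffice for every `v ≤ 32`, in particular for `v = 4 + 2A_K` with `A_K ≤ 14`).
Pure arithmetic; no definitions; nothing asserts any slot, stub, K3 or SC. [folklore]
-/

noncomputable section

namespace Summit.HubbardSuperconductivity.HubbardSuperconductivity.Theorems.KLRegimeSplit

set_option linter.dupNamespace false -- summit = problem name (single-conjunct summit), D-0017

open Real Finset Literature.MathematicalPhysics.QuantumLattice Literature.Probability.LatticeModels
open Summit.HubbardSuperconductivity.HubbardSuperconductivity.Theorems.KLProgrammeLegKernels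

section Deep

variable {L : ℕ}

/-- **Deep from the pair class, abstract jet constant**: `0 ≤ v`, `IsPairClassAt L Q (j + m₀)`, `512·v ≤ 4^{m₀}` ⟹ `v·|p_Q|_𝕋 ≤ Λ_j/16`. [folklore] -/
theorem kldcv_deep_of_isPairClassAt {v : ℝ} (hv : 0 ≤ v) {Q : TorusSite 2 L} {j m₀ : ℕ} (h : IsPairClassAt L Q (j + m₀))
    (hm₀ : 512 * v ≤ (4 : ℝ) ^ m₀) : v * klTorusNorm L Q ≤ klScale klE0 j / 16 := by
  have hs : klTorusNorm L Q ≤ ((4 : ℝ) ^ (j + m₀))⁻¹ := klbj_klTorusNorm_le_of_isPairClassAt h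
  have h4j : (0 : ℝ) < (4 : ℝ) ^ j := by positivity
  have h4m : (0 : ℝ) < (4 : ℝ) ^ m₀ := by positivity
  have hΛ : klScale klE0 j = 1 / 32 * ((4 : ℝ) ^ j)⁻¹ := by simp [klScale, klE0]
  rw [hΛ]
  calc v * klTorusNorm L Q ≤ v * ((4 : ℝ) ^ (j + m₀))⁻¹ := mul_le_mul_of_nonneg_left hs hv
    _ = v / ((4 : ℝ) ^ m₀) * ((4 : ℝ) ^ j)⁻¹ := by rw [pow_add]; field_simp
    _ ≤ 1 / 512 * ((4 : ℝ) ^ j)⁻¹ := by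
        refine mul_le_mul_of_nonneg_right ?_ (by positivity)
        rw [div_le_iff₀ h4m]
        linarith
    _ = 1 / 32 * ((4 : ℝ) ^ j)⁻¹ / 16 := by ring

/-- **The numeral**: `v ≤ 32 ⟹ 512·v ≤ 4⁷` (`4⁷ = 16384 = 512·32`), so `m₀ = 7` edge scales suffice for every jet constant `v ≤ 32`. [folklore] -/
theorem kldcv_numeral_m₀ {v : ℝ} (hv : v ≤ 32) : 512 * v ≤ (4 : ℝ) ^ 7 := by
  norm_num
  linarith

/-- **Deep from the pair class at `m₀ = 7`**: `0 ≤ v ≤ 32`, `IsPairClassAt L Q (j + 7)` ⟹ `v·|p_Q|_𝕋 ≤ Λ_j/16`. [folklore] -/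
theorem kldcv_deep_of_isPairClassAt_seven {v : ℝ} (hv : 0 ≤ v) (hv32 : v ≤ 32) {Q : TorusSite 2 L} {j : ℕ} (h : IsPairClassAt L Q (j + 7)) :
    v * klTorusNorm L Q ≤ klScale klE0 j / 16 :=
  kldcv_deep_of_isPairClassAt hv h (kldcv_numeral_m₀ hv32)

end Deep

end Summit.HubbardSuperconductivity.HubbardSuperconductivity.Theorems.KLRegimeSplit

end
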